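import Summits.CriticalPhenomena.PercolationContinuityZ3.Theorems.PercNearOneGluingNoHeavyLowerTailCovTauStarNReal
import Summits.CriticalPhenomena.PercolationContinuityZ3.Theorems.PercNearOneGluingNoHeavyLowerTailCovTauA2Defs
import HarnessLib

/-!
# The one-source bounds (★) and `Y ≤ B` of the COV(τ) proof
# IN THE VOCABULARY OF THE TWO-SOURCE INDUCTION (`CovTau.Yf / Mf / Bf`)

The two-source induction `CovTau.a2` / `CovTau.p1` (files `…CovTauA2*.lean`, finite-sum framework of `BHK2006.core`:
weights `BHK2006.weight w` on `Set (Sym2 V)`, percolation restricted to `U : Finset V` through `ω ∩ edgesIn U`) takes as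
hypotheses, for every sub-world `U'`, the ONE-SOURCE bounds
* `hstar : Yf w U' x v Ψ N * Mf w U' x v ∅ ≤ Mf w U' x v N * Bf w U' x v Ψ` — Lemma (★_N), and
* `hYB : Yf w U' x v Ψ N ≤ Bf w U' x v Ψ`.
This file PROVES both (`CovTauStarN.yf_mul_mf_le`, `CovTauStarN.yf_le_bf`) from the edge-set form
`CovTauStarN.starN_ED` (file `…CovTauStarNReal.lean`: decision-tree Harris along the exploration of `C_N` + BHK Thm 1.4) by
the dictionary `G[U] ↔ the coordinates pairsIn U` (`sum_weight_restrict`: a `weight`-sum of a function of `ω ∩ edgesIn U` is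
an `ED (pairsIn U)`-expectation — marginal identity `ED_inter_eq`), `sC U N ↔ SetClusterExploration.reached`,
`rest U N = U ∖ C_N ↔ off (C_N)`, `Ψ(vertex cluster) ↔ fcl (liftΨ Ψ x)`; and `Y ≤ B` is the law of total covariance plus the
decision-tree Harris inequality alone (`Cov(E[Ψ(C_x)|ℱ_N], 1{x↔v}) ≥ 0`, no division).
[cite: VandenbergHaggstromKahn2005, Thm. 1.1 (pp. 3–5), Thm. 1.4 (p. 7), eq. (6)] [cite: Gladkov2024, Thm. 3.2 (p. 4)]
-/

noncomputable section

namespace Summit.CriticalPhenomena.PercolationContinuityZ3.Theorems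

namespace CovTauStarN

open Finset MeasureTheory Literature.Probability.Percolation Literature.Probability.Percolation.DecisionTree
open Literature.Probability.Percolation.BHK2006 (weight edgesIn rC rD weight_nonneg)
open SetClusterExploration TreeHarris CovTau
open scoped Classical

/-! ### The marginal identity and the dictionary `G[U]` ↔ coordinates `pairsIn U` -/

section Marginal

variable {ι : Type*} [DecidableEq ι]

/-- **Marginal identity**: for `E ⊆ D`, the `D`-expectation of a function of `K ∩ E` is the `E`-expectation
(integrating out the coordinates of `D ∖ E`). [folklore] -/
theorem ED_inter_eq {D E : Finset ι} (hED : E ⊆ D) (p : ι → ℝ) (φ : Finset ι → ℝ) :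
    ED D p (fun K => φ (K ∩ E)) = ED E p φ := by
  have key : ∀ X : Finset ι, Disjoint X E → ED (E ∪ X) p (fun K => φ (K ∩ E)) = ED E p φ := by
    intro X
    induction X using Finset.induction_on with
    | empty =>
        intro _
        rw [Finset.union_empty]
        exact ED_congr_on E p fun K hK => by rw [Finset.inter_eq_left.2 (Finset.mem_powerset.1 hK)]
    | @insert e X heX ih =>
        intro hdisj
        rw [Finset.disjoint_insert_left] at hdisj
        have hnot : e ∉ E ∪ X := by rw [Finset.mem_union, not_or]; exact ⟨hdisj.1, heX⟩
        have hins : ∀ S : Finset ι, insert e S ∩ E = S ∩ E := fun S => by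
          ext i
          simp only [Finset.mem_inter, Finset.mem_insert]
          constructor
          · rintro ⟨rfl | hi, hiE⟩
            · exact absurd hiE hdisj.1
            · exact ⟨hi, hiE⟩
          · rintro ⟨hi, hiE⟩; exact ⟨Or.inr hi, hiE⟩
        rw [Finset.union_insert, ED_insert p hnot]
        simp only [hins]
        rw [ih hdisj.2]; ring
  rw [← Finset.union_sdiff_of_subset hED]
  exact key (D \ E) Finset.sdiff_disjoint

variable [Fintype ι]

/-- A `weight`-sum over `Set ι` is an `ED univ`-expectation. [folklore] -/
theorem sum_weight_mul_eq_ED (w : ι → ℝ) (g : Set ι → ℝ) :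
    ∑ ω, weight w ω * g ω = ED Finset.univ w (fun K => g ↑K) := by
  unfold ED
  rw [Finset.powerset_univ]
  exact (Fintype.sum_equiv (Fintype.finsetEquivSet (α := ι)) _ _ fun K => by
    rw [Fintype.finsetEquivSet_apply, weight_coe_eq_wtW]).symm

end Marginal

section Dictionary

variable {V : Type*} [Fintype V] [DecidableEq V]

/-- The pairs inside `U` as a finite set of coordinates (`= BHK2006.edgesIn U`). [folklore] -/
def pairsIn (U : Finset V) : Finset (Sym2 V) := Finset.univ.filter fun e => e ∈ edgesIn U

omit [DecidableEq V] in
/-- Membership in `pairsIn`. [folklore] -/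
theorem mem_pairsIn {U : Finset V} {e : Sym2 V} : e ∈ pairsIn U ↔ e ∈ edgesIn U := by
  simp [pairsIn]

/-- `↑(K ∩ pairsIn U) = ↑K ∩ edgesIn U`. [folklore] -/
theorem coe_inter_pairsIn (U : Finset V) (K : Finset (Sym2 V)) :
    (↑(K ∩ pairsIn U) : Set (Sym2 V)) = ↑K ∩ edgesIn U := by
  ext e; simp [pairsIn]

omit [DecidableEq V] in
/-- For `K ⊆ pairsIn U`: `↑K ∩ edgesIn U = ↑K`. [folklore] -/
theorem coe_inter_edgesIn_of_subset {U : Finset V} {K : Finset (Sym2 V)} (hK : K ⊆ pairsIn U) :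
    (↑K : Set (Sym2 V)) ∩ edgesIn U = ↑K :=
  Set.inter_eq_left.2 fun _ he => mem_pairsIn.1 (hK (Finset.mem_coe.1 he))

/-- **Restriction**: a `weight`-sum of a function of `ω ∩ edgesIn U` is an `ED (pairsIn U)`-expectation.
[cite: VandenbergHaggstromKahn2005, §1 p. 3 (the restricted model)] -/
theorem sum_weight_restrict (w : Sym2 V → ℝ) (U : Finset V) (g : Set (Sym2 V) → ℝ)
    (hg : ∀ ω, g ω = g (ω ∩ edgesIn U)) :
    ∑ ω, weight w ω * g ω = ED (pairsIn U) w (fun K => g ↑K) := by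
  rw [sum_weight_mul_eq_ED]
  have : (fun K : Finset (Sym2 V) => g ↑K) = fun K => (fun K' : Finset (Sym2 V) => g ↑K') (K ∩ pairsIn U) := by
    funext K; dsimp only; rw [coe_inter_pairsIn, ← hg]
  have h2 := ED_inter_eq (Finset.subset_univ (pairsIn U)) w (fun K' : Finset (Sym2 V) => g ↑K')
  rw [← this] at h2
  exact h2

/-- The pairs inside `U ∖ W` are the pairs inside `U` missing `W`. [folklore] -/
theorem pairsIn_sdiff (U W : Finset V) : pairsIn (U \ W) = off W (pairsIn U) := by
  ext e
  rw [mem_pairsIn, mem_off, mem_pairsIn]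
  simp only [edgesIn, Set.mem_setOf_eq, Finset.mem_sdiff]
  exact ⟨fun h => ⟨fun v hv => (h v hv).1, fun v hv => (h v hv).2⟩, fun h v hv => ⟨h.1 v hv, h.2 v hv⟩⟩

/-- For `K ⊆ pairsIn U`: `off W K = K ∩ pairsIn (U ∖ W)`. [folklore] -/
theorem off_eq_inter {U : Finset V} (W : Finset V) {K : Finset (Sym2 V)} (hK : K ⊆ pairsIn U) :
    off W K = K ∩ pairsIn (U \ W) := by
  rw [pairsIn_sdiff]
  ext e
  rw [mem_off, Finset.mem_inter, mem_off]
  exact ⟨fun h => ⟨h.1, hK h.1, h.2⟩, fun h => ⟨h.1, h.2.2⟩⟩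

/-- The source set as a `Finset`. [folklore] -/
def srcF (N : Set V) : Finset V := Finset.univ.filter fun u => u ∈ N

omit [DecidableEq V] in
/-- Membership in `srcF`. [folklore] -/
theorem mem_srcF {N : Set V} {u : V} : u ∈ srcF N ↔ u ∈ N := by simp [srcF]

/-- **Set cluster ↔ reached set**: for `K ⊆ pairsIn U`, `CovTau.sC U N ↑K = SetClusterExploration.reached (pairsIn U) (srcF N) K`.
[folklore] -/
theorem mem_sC_iff_mem_reached {U : Finset V} {N : Set V} {K : Finset (Sym2 V)} (hK : K ⊆ pairsIn U) (u : V) :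
    u ∈ sC U N (↑K : Set (Sym2 V)) ↔ u ∈ reached (pairsIn U) (srcF N) K := by
  rw [mem_sC, coe_inter_edgesIn_of_subset hK, mem_reached_iff' hK]
  exact ⟨fun ⟨z, hz, h⟩ => ⟨z, mem_srcF.2 hz, h⟩, fun ⟨z, hz, h⟩ => ⟨z, mem_srcF.1 hz, h⟩⟩

/-- `rest U N ↑K = U ∖ reached` for `K ⊆ pairsIn U`. [folklore] -/
theorem rest_eq_sdiff {U : Finset V} {N : Set V} {K : Finset (Sym2 V)} (hK : K ⊆ pairsIn U) :
    rest U N (↑K : Set (Sym2 V)) = U \ reached (pairsIn U) (srcF N) K := by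
  ext u
  rw [mem_rest, Finset.mem_sdiff, mem_sC_iff_mem_reached hK]

/-- `Ψ` of the VERTEX cluster as a function of the EDGE cluster: `liftΨ Ψ x C = Ψ({x} ∪ V(C))`. [folklore] -/
def liftΨ (Ψ : Set V → ℝ) (x : V) (C : Set (Sym2 V)) : ℝ := Ψ ({x} ∪ {u | ∃ e ∈ C, u ∈ e})

omit [Fintype V] [DecidableEq V] in
/-- `liftΨ` is monotone for monotone `Ψ`. [folklore] -/
theorem liftΨ_mono {Ψ : Set V → ℝ} (hΨ : ∀ S T : Set V, S ⊆ T → Ψ S ≤ Ψ T) (x : V) : Monotone (liftΨ Ψ x) :=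
  fun _ _ hCC' => hΨ _ _ (Set.union_subset_union_right _ fun _ ⟨e, he, hue⟩ => ⟨e, hCC' he, hue⟩)

omit [DecidableEq V] in
/-- The vertex cluster of `x` is `{x} ∪ V(C_x)`: `Ψ(sC U {x} ↑K) = fcl (liftΨ Ψ x) x K` for `K ⊆ pairsIn U`. [folklore] -/
theorem psi_sC_singleton_eq_fcl {U : Finset V} (Ψ : Set V → ℝ) (x : V) {K : Finset (Sym2 V)} (hK : K ⊆ pairsIn U) :
    Ψ (sC U ({x} : Set V) (↑K : Set (Sym2 V))) = fcl (liftΨ Ψ x) x K := by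
  unfold fcl liftΨ
  congr 1
  ext u
  rw [mem_sC_singleton, coe_inter_edgesIn_of_subset hK, reachable_iff_exists_mem_openEdgeCluster]
  simp only [Set.mem_union, Set.mem_singleton_iff, Set.mem_setOf_eq]

omit [DecidableEq V] in
/-- `1{x ↔ v in G[U]}` on `K ⊆ pairsIn U` is `hr x v K`. [folklore] -/
theorem ind_reach_eq_hr {U : Finset V} (x v : V) {K : Finset (Sym2 V)} (hK : K ⊆ pairsIn U) :
    ind {ω : Set (Sym2 V) | (openGraph (ω ∩ edgesIn U)).Reachable x v} (↑K : Set (Sym2 V)) = hr x v K := by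
  unfold hr
  refine BystanderBHK.ind_congr ?_
  simp only [Set.mem_setOf_eq, coe_inter_edgesIn_of_subset hK]

omit [DecidableEq V] in
/-- `1{v ↮ x, v ↮ N in G[U]}` on `K ⊆ pairsIn U` is `(1 − hr x v K)(1 − nr (srcF N) v K)`. [folklore] -/
theorem ind_rD_insert_eq {U : Finset V} (x v : V) (N : Set V) {K : Finset (Sym2 V)} (hK : K ⊆ pairsIn U) :
    ind (rD U v (insert x N)) (↑K : Set (Sym2 V)) = (1 - hr x v K) * (1 - nr (srcF N) v K) := by
  unfold hr nr
  have hmem : (↑K : Set (Sym2 V)) ∈ rD U v (insert x N) ↔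
      ¬ (openGraph (↑K : Set (Sym2 V))).Reachable x v ∧ ¬ ∃ s ∈ srcF N, (openGraph (↑K : Set (Sym2 V))).Reachable s v := by
    simp only [rD, Set.mem_setOf_eq, coe_inter_edgesIn_of_subset hK, Set.mem_insert_iff, forall_eq_or_imp, not_exists,
      not_and, mem_srcF]
    exact ⟨fun h => ⟨fun h' => h.1 h'.symm, fun s hs h' => h.2 s hs h'.symm⟩,
      fun h => ⟨fun h' => h.1 h'.symm, fun s hs h' => h.2 s hs h'.symm⟩⟩
  by_cases h1 : (openGraph (↑K : Set (Sym2 V))).Reachable x v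
  · rw [ind_of_mem (show K ∈ {L : Finset (Sym2 V) | (openGraph (↑L : Set (Sym2 V))).Reachable x v} from h1),
      ind_of_not_mem (show (↑K : Set (Sym2 V)) ∉ rD U v (insert x N) from fun h => (hmem.1 h).1 h1)]
    ring
  · rw [ind_of_not_mem (show K ∉ {L : Finset (Sym2 V) | (openGraph (↑L : Set (Sym2 V))).Reachable x v} from h1)]
    by_cases h2 : ∃ s ∈ srcF N, (openGraph (↑K : Set (Sym2 V))).Reachable s v
    · rw [ind_of_mem (show K ∈ {L : Finset (Sym2 V) | ∃ s ∈ srcF N, (openGraph (↑L : Set (Sym2 V))).Reachable s v} from h2),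
        ind_of_not_mem (show (↑K : Set (Sym2 V)) ∉ rD U v (insert x N) from fun h => (hmem.1 h).2 h2)]
      ring
    · rw [ind_of_not_mem (show K ∉ {L : Finset (Sym2 V) | ∃ s ∈ srcF N, (openGraph (↑L : Set (Sym2 V))).Reachable s v}
          from h2), ind_of_mem (hmem.2 ⟨h1, h2⟩)]
      ring

/-- `1{x ↮ N in G[U]}` on `K ⊆ pairsIn U` is `1{x ∉ reached}`. [folklore] -/
theorem ind_rD_eq {U : Finset V} (x : V) (N : Set V) {K : Finset (Sym2 V)} (hK : K ⊆ pairsIn U) :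
    ind (rD U x N) (↑K : Set (Sym2 V)) = ind {L : Finset (Sym2 V) | x ∉ reached (pairsIn U) (srcF N) L} K := by
  refine BystanderBHK.ind_congr ?_
  rw [← not_mem_sC_iff, Set.mem_setOf_eq, mem_sC_iff_mem_reached hK]

/-! ### `Mf`, `Bf`, `Yf` as `ED`-expressions -/

/-- `Mf w U x v N = E[(1 − hr)(1 − nr)]` on the coordinates `pairsIn U`. [folklore] -/
theorem Mf_eq_ED (w : Sym2 V → ℝ) (U : Finset V) (x v : V) (N : Set V) :
    Mf w U x v N = ED (pairsIn U) w (fun K => (1 - hr x v K) * (1 - nr (srcF N) v K)) := by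
  unfold Mf
  rw [sum_weight_restrict w U _ (fun ω => by
    refine BystanderBHK.ind_congr ?_
    simp only [rD, Set.mem_setOf_eq, Set.inter_assoc, Set.inter_self])]
  exact ED_congr_on _ w fun K hK => ind_rD_insert_eq x v N (Finset.mem_powerset.1 hK)

/-- `Mf w U x v ∅ = E[1 − hr]`. [folklore] -/
theorem Mf_empty_eq_ED (w : Sym2 V → ℝ) (U : Finset V) (x v : V) :
    Mf w U x v ∅ = ED (pairsIn U) w (fun K => 1 - hr x v K) := by
  rw [Mf_eq_ED]
  refine ED_congr_on _ w fun K _ => ?_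
  have : nr (srcF (∅ : Set V)) v K = 0 := ind_of_not_mem fun ⟨s, hs, _⟩ => by
    rw [mem_srcF] at hs; exact hs
  rw [this]; ring

/-- **`Bf` in the world `U ∖ W` is `covOff` on the coordinates `pairsIn U`.** [folklore] -/
theorem Bf_sdiff_eq_covOff (w : Sym2 V → ℝ) (U W : Finset V) (x v : V) (Ψ : Set V → ℝ) :
    Bf w (U \ W) x v Ψ = covOff (pairsIn U) w (liftΨ Ψ x) x v W := by
  have hsub : pairsIn (U \ W) ⊆ pairsIn U := by rw [pairsIn_sdiff]; exact off_subset W _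
  -- each of the three sums of `Bf` restricted to `U ∖ W`
  have h1 : ∑ ω, weight w ω * (Ψ (sC (U \ W) ({x} : Set V) ω) *
      ind {ω : Set (Sym2 V) | (openGraph (ω ∩ edgesIn (U \ W))).Reachable x v} ω) =
      ED (pairsIn (U \ W)) w (fun K => fcl (liftΨ Ψ x) x K * hr x v K) := by
    rw [sum_weight_restrict w (U \ W) _ (fun ω => by
      simp only [sC, Set.inter_assoc, Set.inter_self]
      congr 1
      refine BystanderBHK.ind_congr ?_
      simp only [Set.mem_setOf_eq, Set.inter_assoc, Set.inter_self])]
    exact ED_congr_on _ w fun K hK => by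
      rw [psi_sC_singleton_eq_fcl Ψ x (Finset.mem_powerset.1 hK), ind_reach_eq_hr x v (Finset.mem_powerset.1 hK)]
  have h2 : tf w (U \ W) x Ψ = ED (pairsIn (U \ W)) w (fcl (liftΨ Ψ x) x) := by
    unfold tf
    rw [sum_weight_restrict w (U \ W) _ (fun ω => by
      simp only [sC, Set.inter_assoc, Set.inter_self])]
    exact ED_congr_on _ w fun K hK => psi_sC_singleton_eq_fcl Ψ x (Finset.mem_powerset.1 hK)
  have h3 : cf w (U \ W) x v = ED (pairsIn (U \ W)) w (hr x v) := by
    unfold cf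
    rw [sum_weight_restrict w (U \ W) _ (fun ω => by
      refine BystanderBHK.ind_congr ?_
      simp only [Set.mem_setOf_eq, Set.inter_assoc, Set.inter_self])]
    exact ED_congr_on _ w fun K hK => ind_reach_eq_hr x v (Finset.mem_powerset.1 hK)
  unfold Bf covOff
  rw [h1, h2, h3]
  -- the `covOff` side: functions of `off W K = K ∩ pairsIn (U ∖ W)`
  have e1 : ED (pairsIn U) w (fun K => fcl (liftΨ Ψ x) x (off W K) * hr x v (off W K)) =
      ED (pairsIn (U \ W)) w (fun K => fcl (liftΨ Ψ x) x K * hr x v K) := by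
    rw [← ED_inter_eq hsub w (fun K => fcl (liftΨ Ψ x) x K * hr x v K)]
    exact ED_congr_on _ w fun K hK => by rw [off_eq_inter W (Finset.mem_powerset.1 hK)]
  have e2 : ED (pairsIn U) w (fun K => fcl (liftΨ Ψ x) x (off W K)) = ED (pairsIn (U \ W)) w (fcl (liftΨ Ψ x) x) := by
    rw [← ED_inter_eq hsub w (fcl (liftΨ Ψ x) x)]
    exact ED_congr_on _ w fun K hK => by rw [off_eq_inter W (Finset.mem_powerset.1 hK)]
  have e3 : ED (pairsIn U) w (fun K => hr x v (off W K)) = ED (pairsIn (U \ W)) w (hr x v) := by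
    rw [← ED_inter_eq hsub w (hr x v)]
    exact ED_congr_on _ w fun K hK => by rw [off_eq_inter W (Finset.mem_powerset.1 hK)]
  rw [e1, e2, e3]

/-- `Bf w U x v Ψ = covOff (pairsIn U) w (liftΨ Ψ x) x v ∅`. [folklore] -/
theorem Bf_eq_covOff (w : Sym2 V → ℝ) (U : Finset V) (x v : V) (Ψ : Set V → ℝ) :
    Bf w U x v Ψ = covOff (pairsIn U) w (liftΨ Ψ x) x v ∅ := by
  rw [← Bf_sdiff_eq_covOff, Finset.sdiff_empty]

/-- **`Yf = yN`** on the coordinates `pairsIn U`. [folklore] -/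
theorem Yf_eq_yN (w : Sym2 V → ℝ) (U : Finset V) (x v : V) (Ψ : Set V → ℝ) (N : Set V) :
    Yf w U x v Ψ N = yN (pairsIn U) w (liftΨ Ψ x) x v (srcF N) := by
  unfold Yf yN
  rw [sum_weight_restrict w U _ (fun ω => by
    have h1 : rest U N (ω ∩ edgesIn U) = rest U N ω := by simp only [rest, sC, Set.inter_assoc, Set.inter_self]
    have h2 : ind (rD U x N) (ω ∩ edgesIn U) = ind (rD U x N) ω :=
      BystanderBHK.ind_congr (by simp only [rD, Set.mem_setOf_eq, Set.inter_assoc, Set.inter_self])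
    rw [h1, h2])]
  refine ED_congr_on _ w fun K hK => ?_
  have hK' := Finset.mem_powerset.1 hK
  rw [rest_eq_sdiff hK', Bf_sdiff_eq_covOff, ind_rD_eq x N hK', mul_comm]

end Dictionary

/-! ### `Y ≤ B` (law of total covariance + decision-tree Harris, no division) -/

section YleB

variable {V : Type*} [Fintype V] [DecidableEq V]

/-- **`Y(N) ≤ B(∅)`** on any coordinates `D`: `B(∅) − Y(N) = Cov(E[Ψ(C_x) | ℱ_N], 1{x↔v}) ≥ 0` by the decision-tree Harris
inequality [Gladkov2024, Thm. 3.2] (`TreeHarris.treeHarris_real`).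
[cite: Gladkov2024, Thm. 3.2 (p. 4)] [cite: VandenbergHaggstromKahn2005, eq. (6) (p. 4)] -/
theorem yN_le_covOff (D : Finset (Sym2 V)) {p : Sym2 V → ℝ} (hp0 : ∀ e, 0 ≤ p e) (hp1 : ∀ e, p e ≤ 1)
    (N : Finset V) (x v : V) (Ψ : Set (Sym2 V) → ℝ) (hΨ : Monotone Ψ) (hΨ0 : ∀ C, 0 ≤ Ψ C) :
    yN D p Ψ x v N ≤ covOff D p Ψ x v ∅ := by
  have hSD : SelfDetermined (revealedAt D N) := selfDetermined_revealedAt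
  have hrev : revealed (ttree D (D.card + 1) (init N)) = revealedAt D N :=
    funext fun K => (revealedAt_eq_revealed (D := D) N K).symm
  -- Markov (as in `starN_ED`)
  have hpt : ∀ K ∈ D.powerset, ∀ K₂ ∈ D.powerset,
      (x ∉ reached D N K → fcl Ψ x (splice (revealedAt D N K) K K₂) = fcl Ψ x (off (reached D N K) K₂) ∧
        hr x v (splice (revealedAt D N K) K K₂) = hr x v (off (reached D N K) K₂)) ∧
      (x ∈ reached D N K → fcl Ψ x (splice (revealedAt D N K) K K₂) = fcl Ψ x K ∧
        hr x v (splice (revealedAt D N K) K K₂) = hr x v K) := by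
    intro K hK K₂ hK₂
    rw [Finset.mem_powerset] at hK hK₂
    refine ⟨fun hx => ?_, fun hx => ?_⟩
    · obtain ⟨hreach, hclu⟩ := splice_congr_of_not_mem_reached hK hK₂ hx
      exact ⟨by simp only [fcl, hclu], BystanderBHK.ind_congr (hreach v).symm⟩
    · obtain ⟨hreach, hclu⟩ := splice_congr_of_mem_reached hK hK₂ hx
      exact ⟨by simp only [fcl, hclu], BystanderBHK.ind_congr (hreach v).symm⟩
  -- `Y(N) = E[Ψ 1_v] − E[ĝ ĥ]`
  have hY : yN D p Ψ x v N = ED D p (fun K => fcl Ψ x K * hr x v K) -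
      ED D p (fun K => cE D p (revealedAt D N) (fcl Ψ x) K * cE D p (revealedAt D N) (hr x v) K) := by
    rw [← ED_cE D p hSD (fun K => fcl Ψ x K * hr x v K), ← ED_sub]
    refine ED_congr_on D p fun K hK => ?_
    by_cases hx : x ∈ reached D N K
    · rw [ind_of_not_mem (show K ∉ {L : Finset (Sym2 V) | x ∉ reached D N L} from fun h' => h' hx), zero_mul]
      have e1 : cE D p (revealedAt D N) (fun L => fcl Ψ x L * hr x v L) K = fcl Ψ x K * hr x v K :=
        calc cE D p (revealedAt D N) (fun L => fcl Ψ x L * hr x v L) K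
            = ∑ K₂ ∈ D.powerset, wtW D p K₂ * (fcl Ψ x K * hr x v K) :=
              Finset.sum_congr rfl fun K₂ hK₂ => by
                show wtW D p K₂ * (fcl Ψ x _ * hr x v _) = _
                rw [((hpt K hK K₂ hK₂).2 hx).1, ((hpt K hK K₂ hK₂).2 hx).2]
          _ = fcl Ψ x K * hr x v K := by rw [← Finset.sum_mul, sum_wtW, one_mul]
      have e2 : cE D p (revealedAt D N) (fcl Ψ x) K = fcl Ψ x K :=
        calc cE D p (revealedAt D N) (fcl Ψ x) K = ∑ K₂ ∈ D.powerset, wtW D p K₂ * fcl Ψ x K :=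
              Finset.sum_congr rfl fun K₂ hK₂ => by rw [((hpt K hK K₂ hK₂).2 hx).1]
          _ = fcl Ψ x K := by rw [← Finset.sum_mul, sum_wtW, one_mul]
      have e3 : cE D p (revealedAt D N) (hr x v) K = hr x v K :=
        calc cE D p (revealedAt D N) (hr x v) K = ∑ K₂ ∈ D.powerset, wtW D p K₂ * hr x v K :=
              Finset.sum_congr rfl fun K₂ hK₂ => by rw [((hpt K hK K₂ hK₂).2 hx).2]
          _ = hr x v K := by rw [← Finset.sum_mul, sum_wtW, one_mul]
      rw [e1, e2, e3]; ring
    · rw [ind_of_mem (show K ∈ {L : Finset (Sym2 V) | x ∉ reached D N L} from hx), one_mul]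
      have e1 : cE D p (revealedAt D N) (fun L => fcl Ψ x L * hr x v L) K =
          ED D p (fun K₂ => fcl Ψ x (off (reached D N K) K₂) * hr x v (off (reached D N K) K₂)) :=
        Finset.sum_congr rfl fun K₂ hK₂ => by
          show wtW D p K₂ * (fcl Ψ x _ * hr x v _) = _
          rw [((hpt K hK K₂ hK₂).1 hx).1, ((hpt K hK K₂ hK₂).1 hx).2]
      have e2 : cE D p (revealedAt D N) (fcl Ψ x) K = ED D p (fun K₂ => fcl Ψ x (off (reached D N K) K₂)) :=
        Finset.sum_congr rfl fun K₂ hK₂ => by rw [((hpt K hK K₂ hK₂).1 hx).1]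
      have e3 : cE D p (revealedAt D N) (hr x v) K = ED D p (fun K₂ => hr x v (off (reached D N K) K₂)) :=
        Finset.sum_congr rfl fun K₂ hK₂ => by rw [((hpt K hK K₂ hK₂).1 hx).2]
      rw [e1, e2, e3]; rfl
  have hC : ED D p (fun K => cE D p (revealedAt D N) (fcl Ψ x) K * cE D p (revealedAt D N) (hr x v) K) =
      ED D p (fun K => cE D p (revealedAt D N) (fcl Ψ x) K * hr x v K) := by
    rw [ED_mul_cE_comm D p hSD (cE D p (revealedAt D N) (fcl Ψ x)) (hr x v)]
    exact ED_congr_on D p fun K _ => by rw [cE_cE D p (revealedAt D N) hSD (fcl Ψ x) K]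
  -- decision-tree Harris for `{x ↔ v}`
  have hUp : IsUpperSet {L : Finset (Sym2 V) | (openGraph (↑L : Set (Sym2 V))).Reachable x v} :=
    fun L L' hLL' hL => hL.mono (openGraph_mono (Finset.coe_subset.2 hLL'))
  have hTH := treeHarris_real D hp0 hp1 (ttree D (D.card + 1) (init N)) (fcl_mono Ψ x hΨ) (fun K => hΨ0 _) hUp
  rw [hrev, PrW_eq_sum_ind] at hTH
  change ED D p (fcl Ψ x) * ED D p (hr x v) ≤ ED D p (fun K => cE D p (revealedAt D N) (fcl Ψ x) K * hr x v K) at hTH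
  have hB0 : covOff D p Ψ x v ∅ = ED D p (fun K => fcl Ψ x K * hr x v K) - ED D p (fcl Ψ x) * ED D p (hr x v) := by
    simp only [covOff, off_empty]
  rw [hY, hC, hB0]
  linarith

end YleB

/-! ### The one-source bounds in `CovTau` vocabulary -/

section Discharge

variable {V : Type*} [Fintype V] [DecidableEq V]

/-- **(★) in every world `G[U]`, `CovTau` vocabulary**: `Yf·Mf ∅ ≤ Mf N·Bf` — the hypothesis `hstar` of `CovTau.a2` /
`CovTau.p1`, proved from `CovTauStarN.starN_ED`. [cite: Gladkov2024, Thm. 3.2 (p. 4)]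
[cite: VandenbergHaggstromKahn2005, Thm. 1.4 (p. 7), eq. (6) (p. 4)] -/
theorem yf_mul_mf_le (w : Sym2 V → ℝ) (hw0 : ∀ e, 0 ≤ w e) (hw1 : ∀ e, w e ≤ 1) (x v : V) {Ψ : Set V → ℝ}
    (hΨ : ∀ S T : Set V, S ⊆ T → Ψ S ≤ Ψ T) (hΨ0 : ∀ S, 0 ≤ Ψ S) (U : Finset V) (N : Set V) :
    Yf w U x v Ψ N * Mf w U x v ∅ ≤ Mf w U x v N * Bf w U x v Ψ := by
  rw [Yf_eq_yN, Mf_empty_eq_ED, Mf_eq_ED, Bf_eq_covOff]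
  exact starN_ED (pairsIn U) hw0 hw1 (srcF N) x v (liftΨ Ψ x) (liftΨ_mono hΨ x) (fun _ => hΨ0 _)

/-- **`Y ≤ B` in every world `G[U]`, `CovTau` vocabulary**: the hypothesis `hYB` of `CovTau.a2` / `CovTau.p1`.
[cite: Gladkov2024, Thm. 3.2 (p. 4)] -/
theorem yf_le_bf (w : Sym2 V → ℝ) (hw0 : ∀ e, 0 ≤ w e) (hw1 : ∀ e, w e ≤ 1) (x v : V) {Ψ : Set V → ℝ}
    (hΨ : ∀ S T : Set V, S ⊆ T → Ψ S ≤ Ψ T) (hΨ0 : ∀ S, 0 ≤ Ψ S) (U : Finset V) (N : Set V) :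
    Yf w U x v Ψ N ≤ Bf w U x v Ψ := by
  rw [Yf_eq_yN, Bf_eq_covOff]
  exact yN_le_covOff (pairsIn U) hw0 hw1 (srcF N) x v (liftΨ Ψ x) (liftΨ_mono hΨ x) (fun _ => hΨ0 _)

end Discharge

end CovTauStarN

end Summit.CriticalPhenomena.PercolationContinuityZ3.Theorems

end
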